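/- Free lead seat `ym-line-cbag-p1` (prover-ym-line-cbag-p1-g20-0; own crux `BoxFloorAllGroups` stmt-QuantumFields-22254 CLOSED) on the
planner-of-record's LINE 5, route `HankelDensitySplitting`: REGISTERED STUB 3 `stub_hankelLogConvex : HankelLogConvex` of the birth skeleton of crux
`HankelDensityFloor` (stmt-QuantumFields-26618) — II: passage to the infinite-volume limit states and the stub.  RECORD-type material; the
Yang–Mills mass gap is NOT proved by anything here, and the crux stays open (door 1, the cross-plane fixed-distance law). -/
import Summits.QuantumFields.YangMills.Theorems.HankelDensitySplittingHankelDensityFloorDefs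
import Summits.QuantumFields.YangMills.Theorems.HankelDensitySplittingHankelDensityFloorLogConvexCones
import Summits.QuantumFields.YangMills.Theorems.HankelDensitySplittingTorusLimitTransfer
import Summits.QuantumFields.YangMills.Theorems.HankelDensitySplittingAssembly
import Summits.QuantumFields.YangMills.Theorems.DirichletWindowAxialLogConvexity

/-!
# `HankelLogConvex` (stub 3 of crux `HankelDensityFloor`, route `HankelDensitySplitting`) — II: the limit, and the stub

`HankelLogConvex`: for every compact simple `G`, faithful unitary `r`, `β ≥ 0`, every `μ ∈ infiniteVolumeLimitPoints r.ρ β` and `n ≥ 1`: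
`0 ≤ F_μ(n)`, `F_μ(n+1) ≤ F_μ(n)`, `F_μ(n+1)² ≤ F_μ(n) F_μ(n+2)` for the reflection-paired density correlator `F_μ = hF r.ρ μ`
(`HankelDensitySplittingHankelDensityFloorDefs`).

* `tendsto_pairCov`: along the defining tori of `μ`, the torus covariance of two axial plaquettes in ANY two planes converges to the
  corresponding `plaquetteCorr` of `μ` (bounded continuous cylinder observables; the torus restriction of a `ℤ⁴` plaquette observable is the
  torus plaquette observable).  Hence the torus reflection-paired correlator `F_{L_k+1}(n)` of part I converges to `F_μ(n)` for `n ≥ 1`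
  (`tendsto_torusF`, `hF_eq_sum_planes`).
* The closed inequalities of part I (`LogConvex.torusF_nonneg`, `LogConvex.torusF_logConvex`) pass to the limit; `F_μ(0) = Var_μ(tr F²(0)) ≥ 0`
  (`hF_zero_nonneg`, via the landed `sum_split` / `sum_plaquetteCorr_eq_cov`) and `F_μ(n) ≤ 640 N²` (`hF_le`); a bounded non-negative sequence,
  log-convex from index `1`, is non-increasing from index `1` (`AxialLogConvexity.antitone_step_of_logConvex`).
* `stub_hankelLogConvex` — the registered stub BY NAME.  The simplicity of `G` is not used.

References: K. Osterwalder, E. Seiler, Ann. Phys. 110 (1978) 440, §2; E. Seiler, LNP 159 (1982) Ch. 2.  NOT the Yang–Mills mass gap; the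
crux `HankelDensityFloor` is not proved here.
-/

noncomputable section

open MeasureTheory ProbabilityTheory Filter Topology
open Literature.MathematicalPhysics.QuantumFieldTheory
open Literature.MathematicalPhysics.QuantumLattice

namespace Summit.QuantumFields.YangMills.Theorems.HankelDensitySplitting

namespace LogConvex

variable {G : Type} [Group G] [TopologicalSpace G] [IsTopologicalGroup G] [CompactSpace G]
  [MeasurableSpace G] [BorelSpace G] {N : ℕ} (ρ : G →* Matrix (Fin N) (Fin N) ℂ)

/-! ### Plaquette observables of `ℤ⁴` in an arbitrary plane: torus restriction, bounds, cylinder property -/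

section Plane

omit [TopologicalSpace G] [IsTopologicalGroup G] [CompactSpace G] [MeasurableSpace G] [BorelSpace G] in
/-- The torus restriction of the `ℤ⁴` plaquette observable in the plane `q` is the torus plaquette observable at the projected base point.
[folklore] -/
theorem toTorusObservable_plaquetteObs_plane (M : ℕ) (y : Literature.Probability.LatticeModels.Site 4)
    (q : {p : Fin 4 × Fin 4 // p.1 < p.2}) :
    toTorusObservable M (plaquetteObs (G := G) ρ y q.1.1 q.1.2) = fun U =>
      WilsonRP.plaqRe ρ U (Literature.Probability.LatticeModels.Torus.proj M y, q) := by
  funext U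
  simp only [toTorusObservable_apply, plaquetteObs, WilsonRP.plaqRe, AxialLogConvexity.plaquetteHolonomyZd_torusLift]

omit [MeasurableSpace G] [BorelSpace G] in
/-- `|Re tr ρ(U_p)| ≤ N` for a continuous representation (unitarian trick), any plane. [folklore] -/
theorem abs_plaquetteObs_le_cont (hρ : Continuous ρ) (y : Literature.Probability.LatticeModels.Site 4) (i j : Fin 4)
    (U : LGConfig 4 G) : |plaquetteObs ρ y i j U| ≤ N := by
  show |(ρ (plaquetteHolonomyZd U y i j)).trace.re| ≤ (N : ℝ)
  have h := Literature.RepresentationTheory.CompactGroups.CompactGroup.abs_re_trace_le_card ρ hρ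
    (plaquetteHolonomyZd U y i j)
  rwa [Fintype.card_fin] at h

end Plane

/-! ### Convergence of the torus pair covariances to the pair correlations of the limit state -/

section Limit

/-- **The torus covariance of two axial plaquettes, in any two planes, converges to the pair correlation of the limit point** along its
defining subsequence of tori: `Cov_{β,L_k+1}(P(0,q), P(c e₀,q')) → plaquetteCorr ρ μ 0 q (c e₀) q'`. [folklore] -/
theorem tendsto_pairCov (hρ : Continuous ρ) {β : ℝ} {μ : Measure (LGConfig 4 G)} {Ls : ℕ → ℕ}
    (hlim : IsInfiniteVolumeLimitAlong (d := 4) ρ β Ls μ) (q q' : {p : Fin 4 × Fin 4 // p.1 < p.2}) (c : ℕ) :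
    Tendsto (fun k : ℕ =>
      cov[fun U => WilsonRP.plaqRe ρ U ((Pi.single 0 0 : Site 4 (Ls k + 1)), q),
        fun U => WilsonRP.plaqRe ρ U ((Pi.single 0 ((c : ℕ) : ZMod (Ls k + 1)) : Site 4 (Ls k + 1)), q');
        wilsonMeasure (d := 4) (L := Ls k + 1) ρ β]) atTop
      (𝓝 (plaquetteCorr ρ μ 0 q.1.1 q.1.2 ((c : ℤ) • Pi.single (0 : Fin 4) (1 : ℤ)) q'.1.1 q'.1.2)) := by
  set x : Literature.Probability.LatticeModels.Site 4 := (c : ℤ) • Pi.single (0 : Fin 4) (1 : ℤ) with hx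
  have hc0 := continuous_plaquetteObs (G := G) ρ hρ (0 : Literature.Probability.LatticeModels.Site 4) q.1.1 q.1.2
  have hcx := continuous_plaquetteObs (G := G) ρ hρ x q'.1.1 q'.1.2
  have hb0 : ∃ C, ∀ U : LGConfig 4 G,
      |plaquetteObs ρ (0 : Literature.Probability.LatticeModels.Site 4) q.1.1 q.1.2 U| ≤ C :=
    ⟨N, abs_plaquetteObs_le_cont ρ hρ 0 _ _⟩
  have hbx : ∃ C, ∀ U : LGConfig 4 G, |plaquetteObs ρ x q'.1.1 q'.1.2 U| ≤ C :=
    ⟨N, abs_plaquetteObs_le_cont ρ hρ x _ _⟩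
  have hcyl0 := isCylinder_plaquetteObs (d := 4) ρ ((0 : Literature.Probability.LatticeModels.Site 4), q)
  have hcylx := isCylinder_plaquetteObs (d := 4) ρ (x, q')
  -- the three convergences
  have h0 := hlim.2 _ _ hcyl0 hc0 hb0
  have h1 := hlim.2 _ _ hcylx hcx hbx
  have h2 := hlim.2
    (fun U => plaquetteObs ρ (0 : Literature.Probability.LatticeModels.Site 4) q.1.1 q.1.2 U * plaquetteObs ρ x q'.1.1 q'.1.2 U)
    _ (IsCylinder.mul hcyl0 hcylx) (hc0.mul hcx)
    ⟨N * N, fun U => by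
      rw [abs_mul]
      exact mul_le_mul (abs_plaquetteObs_le_cont ρ hρ 0 q.1.1 q.1.2 U) (abs_plaquetteObs_le_cont ρ hρ x q'.1.1 q'.1.2 U)
        (abs_nonneg _) ((abs_nonneg _).trans (abs_plaquetteObs_le_cont ρ hρ 0 q.1.1 q.1.2 U))⟩
  have h := h2.sub (h0.mul h1)
  refine h.congr fun k => ?_
  -- identify the torus quantities
  haveI := isProbabilityMeasure_wilsonMeasure (d := 4) (L := Ls k + 1) ρ hρ β
  have hT : toTorusObservable (Ls k + 1)
      (fun U => plaquetteObs ρ (0 : Literature.Probability.LatticeModels.Site 4) q.1.1 q.1.2 U *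
        plaquetteObs ρ x q'.1.1 q'.1.2 U) =
      fun U : GaugeConfig 4 (Ls k + 1) G =>
        WilsonRP.plaqRe ρ U ((Pi.single 0 (0 : ZMod (Ls k + 1)) : Site 4 (Ls k + 1)), q) *
          WilsonRP.plaqRe ρ U ((Pi.single 0 (c : ZMod (Ls k + 1)) : Site 4 (Ls k + 1)), q') := by
    funext U
    simp only [toTorusObservable_apply, hx, plaquetteObs, WilsonRP.plaqRe, AxialLogConvexity.plaquetteHolonomyZd_torusLift,
      AxialLogConvexity.proj_zero, AxialLogConvexity.proj_zsmul_single]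
  rw [hT, toTorusObservable_plaquetteObs_plane, toTorusObservable_plaquetteObs_plane, AxialLogConvexity.proj_zero, hx,
    AxialLogConvexity.proj_zsmul_single]
  unfold wilsonExpectation
  rw [covariance_eq_sub (AxialLogConvexity.memLp_tplaq ρ hρ β _) (AxialLogConvexity.memLp_tplaq ρ hρ β _)]
  rfl

/-- **The torus reflection-paired correlators converge to the crux's `F_μ`, plane-pair form** (`n ≥ 1`): along the defining tori of `μ`,
`Σ_q Σ_{q'} Cov_{β,L_k+1}(P(0,q), P((n − s(q)) e₀, q')) → Σ_q Σ_{q'} plaquetteCorr ρ μ 0 q ((n − s(q)) e₀) q'`. [folklore] -/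
theorem tendsto_torusF (hρ : Continuous ρ) {β : ℝ} {μ : Measure (LGConfig 4 G)} {Ls : ℕ → ℕ}
    (hlim : IsInfiniteVolumeLimitAlong (d := 4) ρ β Ls μ) {n : ℕ} (hn : 1 ≤ n) :
    Tendsto (fun k : ℕ => ∑ q : {p : Fin 4 × Fin 4 // p.1 < p.2}, ∑ q' : {p : Fin 4 × Fin 4 // p.1 < p.2},
      cov[fun U => WilsonRP.plaqRe ρ U ((Pi.single 0 0 : Site 4 (Ls k + 1)), q),
        fun U => WilsonRP.plaqRe ρ U ((Pi.single 0 (((n : ℕ) : ZMod (Ls k + 1)) -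
          (if q.1.1 = 0 then (0 : ZMod (Ls k + 1)) else 1)) : Site 4 (Ls k + 1)), q');
        wilsonMeasure (d := 4) (L := Ls k + 1) ρ β]) atTop
      (𝓝 (∑ q : {p : Fin 4 × Fin 4 // p.1 < p.2}, ∑ q' : {p : Fin 4 × Fin 4 // p.1 < p.2},
        plaquetteCorr ρ μ 0 q.1.1 q.1.2 ((((if q.1.1 = 0 then n else n - 1 : ℕ)) : ℤ) • Pi.single (0 : Fin 4) (1 : ℤ))
          q'.1.1 q'.1.2)) := by
  refine tendsto_finsetSum _ fun q _ => tendsto_finsetSum _ fun q' _ => ?_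
  by_cases hq : q.1.1 = 0
  · simp only [if_pos hq, sub_zero]
    exact tendsto_pairCov ρ hρ hlim q q' n
  · simp only [if_neg hq, ← Nat.cast_pred hn]
    exact tendsto_pairCov ρ hρ hlim q q' (n - 1)

end Limit

/-! ### The crux's `F_μ` in plane-pair form; its value at `0`; a bound -/

section LimitState

omit [TopologicalSpace G] [IsTopologicalGroup G] [CompactSpace G] [BorelSpace G] in
/-- A guarded double sum over `Fin 4` is a sum over the ordered planes. [folklore] -/
theorem sum_ite_lt_eq_sum_planes (f : Fin 4 → Fin 4 → ℝ) :
    (∑ k : Fin 4, ∑ l : Fin 4, if k < l then f k l else 0) = ∑ q : {p : Fin 4 × Fin 4 // p.1 < p.2}, f q.1.1 q.1.2 := by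
  calc (∑ k : Fin 4, ∑ l : Fin 4, if k < l then f k l else 0)
      = ∑ p : Fin 4 × Fin 4, if p.1 < p.2 then f p.1 p.2 else 0 := by rw [Fintype.sum_prod_type]
    _ = ∑ p ∈ Finset.univ.filter (fun p : Fin 4 × Fin 4 => p.1 < p.2), f p.1 p.2 := by rw [Finset.sum_filter]
    _ = ∑ q : {p : Fin 4 × Fin 4 // p.1 < p.2}, f q.1.1 q.1.2 :=
        Finset.sum_subtype (Finset.univ.filter fun p : Fin 4 × Fin 4 => p.1 < p.2) (fun p => by simp)
          (fun p : Fin 4 × Fin 4 => f p.1 p.2)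

omit [TopologicalSpace G] [IsTopologicalGroup G] [CompactSpace G] [BorelSpace G] in
/-- A guarded four-fold sum over `Fin 4` is a double sum over ordered plane pairs. [folklore] -/
theorem sum4_ite_eq_sum_planes (g : Fin 4 → Fin 4 → Fin 4 → Fin 4 → ℝ) :
    (∑ i : Fin 4, ∑ j : Fin 4, ∑ k : Fin 4, ∑ l : Fin 4, if i < j ∧ k < l then g i j k l else 0) =
      ∑ q : {p : Fin 4 × Fin 4 // p.1 < p.2}, ∑ q' : {p : Fin 4 × Fin 4 // p.1 < p.2}, g q.1.1 q.1.2 q'.1.1 q'.1.2 := by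
  have step1 : (∑ i : Fin 4, ∑ j : Fin 4, ∑ k : Fin 4, ∑ l : Fin 4, if i < j ∧ k < l then g i j k l else 0) =
      ∑ i : Fin 4, ∑ j : Fin 4, if i < j then (∑ k : Fin 4, ∑ l : Fin 4, if k < l then g i j k l else 0) else 0 := by
    refine Finset.sum_congr rfl fun i _ => Finset.sum_congr rfl fun j _ => ?_
    by_cases hij : i < j
    · simp only [hij, true_and, ↓reduceIte]
    · simp only [hij, false_and, ↓reduceIte, Finset.sum_const_zero]
  rw [step1, sum_ite_lt_eq_sum_planes (fun i j => ∑ k : Fin 4, ∑ l : Fin 4, if k < l then g i j k l else 0)]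
  exact Finset.sum_congr rfl fun q _ => sum_ite_lt_eq_sum_planes (g q.1.1 q.1.2)

omit [TopologicalSpace G] [IsTopologicalGroup G] [CompactSpace G] [BorelSpace G] in
/-- **Plane-pair form of the crux's `F_μ`**: `hF ρ μ n = Σ_q Σ_{q'} plaquetteCorr ρ μ 0 q ((n − s(q)) e₀) q'` with `n − s(q) = n` for the
temporal and `n − 1` (natural subtraction) for the spatial planes at the origin. [folklore] -/
theorem hF_eq_sum_planes (μ : Measure (LGConfig 4 G)) (n : ℕ) :
    hF ρ μ n = ∑ q : {p : Fin 4 × Fin 4 // p.1 < p.2}, ∑ q' : {p : Fin 4 × Fin 4 // p.1 < p.2},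
      plaquetteCorr ρ μ 0 q.1.1 q.1.2 ((((if q.1.1 = 0 then n else n - 1 : ℕ)) : ℤ) • Pi.single (0 : Fin 4) (1 : ℤ))
        q'.1.1 q'.1.2 := by
  -- the pair correlation with the plane-dependent separation, as an opaque function of the four indices
  set g : Fin 4 → Fin 4 → Fin 4 → Fin 4 → ℝ := fun i j k l => plaquetteCorr ρ μ 0 i j
    ((((if i = 0 then n else n - 1 : ℕ)) : ℤ) • Pi.single (0 : Fin 4) (1 : ℤ)) k l with hg
  have e1 : (∑ j : Fin 4, ∑ k : Fin 4, ∑ l : Fin 4,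
      if 0 < j ∧ k < l then plaquetteCorr ρ μ 0 0 j (((n : ℕ) : ℤ) • Pi.single (0 : Fin 4) (1 : ℤ)) k l else 0) =
      ∑ j : Fin 4, ∑ k : Fin 4, ∑ l : Fin 4, if 0 < j ∧ k < l then g 0 j k l else 0 := by
    refine Finset.sum_congr rfl fun j _ => Finset.sum_congr rfl fun k _ => Finset.sum_congr rfl fun l _ => ?_
    rw [hg]
    simp only [↓reduceIte]
  have e2 : (∑ i : Fin 4, ∑ j : Fin 4, ∑ k : Fin 4, ∑ l : Fin 4,
      if 0 < i ∧ i < j ∧ k < l then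
        plaquetteCorr ρ μ 0 i j (((n - 1 : ℕ) : ℤ) • Pi.single (0 : Fin 4) (1 : ℤ)) k l else 0) =
      ∑ i : Fin 4, ∑ j : Fin 4, ∑ k : Fin 4, ∑ l : Fin 4, if 0 < i ∧ i < j ∧ k < l then g i j k l else 0 := by
    refine Finset.sum_congr rfl fun i _ => Finset.sum_congr rfl fun j _ => Finset.sum_congr rfl fun k _ =>
      Finset.sum_congr rfl fun l _ => ?_
    by_cases h : 0 < i ∧ i < j ∧ k < l
    · rw [if_pos h, if_pos h, hg]
      simp only [if_neg (ne_of_gt h.1)]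
    · rw [if_neg h, if_neg h]
  unfold hF
  rw [e1, e2, ← sum_split g, sum4_ite_eq_sum_planes g]

/-- `F_μ(0) = Var_μ(tr F²(0)) ≥ 0` for a probability measure `μ` (both halves of `hF ρ μ 0` sit at separation `0`; `sum_split` and
`sum_plaquetteCorr_eq_cov` of the sibling files). [folklore] -/
theorem hF_zero_nonneg (hρ : Continuous ρ) (hρu : ∀ g, ρ g ∈ Matrix.unitaryGroup (Fin N) ℂ) [SecondCountableTopology G]
    (μ : Measure (LGConfig 4 G)) [IsProbabilityMeasure μ] : 0 ≤ hF ρ μ 0 := by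
  have hs := sum_split (fun i j k l => plaquetteCorr ρ μ 0 i j (((0 : ℕ) : ℤ) • Pi.single (0 : Fin 4) (1 : ℤ)) k l)
  beta_reduce at hs
  have h0 : hF ρ μ 0 = ∑ i : Fin 4, ∑ j : Fin 4, ∑ k : Fin 4, ∑ l : Fin 4,
      if i < j ∧ k < l then plaquetteCorr ρ μ 0 i j (((0 : ℕ) : ℤ) • Pi.single (0 : Fin 4) (1 : ℤ)) k l else 0 := by
    unfold hF
    rw [hs]
  rw [h0, sum_plaquetteCorr_eq_cov ρ hρ hρu μ 0]
  have hshift : ∀ U : LGConfig 4 G, configShift (-Pi.single (0 : Fin 4) ((0 : ℕ) : ℤ)) U = U := by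
    intro U
    ext e
    simp [configShift_apply]
  simp only [hshift]
  have hX : MemLp (actionDensity ρ) 2 μ := by
    obtain ⟨C, hC⟩ := (isCompact_univ.image (continuous_abs.comp (continuous_actionDensity hρ))).isBounded.bddAbove
    refine memLp_of_bounded (a := -C) (b := C) (ae_of_all _ fun U => ?_)
      (continuous_actionDensity hρ).measurable.aestronglyMeasurable 2
    exact Set.mem_Icc.2 (abs_le.1 (hC ⟨U, Set.mem_univ _, rfl⟩))
  have hc : cov[actionDensity ρ, actionDensity ρ; μ] =
      (∫ U, actionDensity ρ U * actionDensity ρ U ∂μ) - (∫ U, actionDensity ρ U ∂μ) * ∫ U, actionDensity ρ U ∂μ := by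
    rw [covariance_eq_sub hX hX]; rfl
  rw [← hc, covariance_self hX.aestronglyMeasurable.aemeasurable]
  exact variance_nonneg _ _

omit [BorelSpace G] in
/-- Each pair correlation of a probability state is at most `2N²`. [folklore] -/
theorem plaquetteCorr_le (hρ : Continuous ρ) (μ : Measure (LGConfig 4 G)) [IsProbabilityMeasure μ]
    (x y : Literature.Probability.LatticeModels.Site 4) (i j k l : Fin 4) :
    plaquetteCorr ρ μ x i j y k l ≤ 2 * (N : ℝ) ^ 2 := by
  unfold plaquetteCorr
  have hbd : ∀ U, ‖plaquetteObs ρ x i j U * plaquetteObs ρ y k l U‖ ≤ (N : ℝ) ^ 2 := fun U => by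
    rw [Real.norm_eq_abs, abs_mul, sq]
    exact mul_le_mul (abs_plaquetteObs_le_cont ρ hρ x i j U) (abs_plaquetteObs_le_cont ρ hρ y k l U) (abs_nonneg _)
      (Nat.cast_nonneg _)
  have h1 : (∫ U, plaquetteObs ρ x i j U * plaquetteObs ρ y k l U ∂μ) ≤ (N : ℝ) ^ 2 :=
    calc _ ≤ ‖∫ U, plaquetteObs ρ x i j U * plaquetteObs ρ y k l U ∂μ‖ := Real.le_norm_self _
      _ ≤ (N : ℝ) ^ 2 * μ.real Set.univ := norm_integral_le_of_norm_le_const (Eventually.of_forall hbd)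
      _ = (N : ℝ) ^ 2 := by rw [probReal_univ, mul_one]
  have hX : |∫ U, plaquetteObs ρ x i j U ∂μ| ≤ N := by
    calc _ = ‖∫ U, plaquetteObs ρ x i j U ∂μ‖ := (Real.norm_eq_abs _).symm
      _ ≤ (N : ℝ) * μ.real Set.univ := norm_integral_le_of_norm_le_const (Eventually.of_forall fun U => by
          rw [Real.norm_eq_abs]; exact abs_plaquetteObs_le_cont ρ hρ x i j U)
      _ = N := by rw [probReal_univ, mul_one]
  have hY : |∫ U, plaquetteObs ρ y k l U ∂μ| ≤ N := by
    calc _ = ‖∫ U, plaquetteObs ρ y k l U ∂μ‖ := (Real.norm_eq_abs _).symm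
      _ ≤ (N : ℝ) * μ.real Set.univ := norm_integral_le_of_norm_le_const (Eventually.of_forall fun U => by
          rw [Real.norm_eq_abs]; exact abs_plaquetteObs_le_cont ρ hρ y k l U)
      _ = N := by rw [probReal_univ, mul_one]
  have h2 : -((∫ U, plaquetteObs ρ x i j U ∂μ) * ∫ U, plaquetteObs ρ y k l U ∂μ) ≤ (N : ℝ) ^ 2 := by
    have := abs_mul (∫ U, plaquetteObs ρ x i j U ∂μ) (∫ U, plaquetteObs ρ y k l U ∂μ)
    have hprod : |(∫ U, plaquetteObs ρ x i j U ∂μ) * ∫ U, plaquetteObs ρ y k l U ∂μ| ≤ (N : ℝ) ^ 2 := by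
      rw [this, sq]
      exact mul_le_mul hX hY (abs_nonneg _) (Nat.cast_nonneg _)
    linarith [neg_abs_le ((∫ U, plaquetteObs ρ x i j U ∂μ) * ∫ U, plaquetteObs ρ y k l U ∂μ)]
  linarith

omit [BorelSpace G] in
/-- A crude bound: `F_μ(n) ≤ 640 N²`. [folklore] -/
theorem hF_le (hρ : Continuous ρ) (μ : Measure (LGConfig 4 G)) [IsProbabilityMeasure μ] (n : ℕ) :
    hF ρ μ n ≤ 640 * (N : ℝ) ^ 2 := by
  have hb0 : (0 : ℝ) ≤ 2 * (N : ℝ) ^ 2 := by positivity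
  have s1 : (∑ j : Fin 4, ∑ k : Fin 4, ∑ l : Fin 4,
      if 0 < j ∧ k < l then
          plaquetteCorr ρ μ 0 0 j (((n : ℕ) : ℤ) • Pi.single (0 : Fin 4) (1 : ℤ)) k l else 0) ≤
        ∑ j : Fin 4, ∑ k : Fin 4, ∑ l : Fin 4, 2 * (N : ℝ) ^ 2 :=
    Finset.sum_le_sum fun j _ => Finset.sum_le_sum fun k _ => Finset.sum_le_sum fun l _ => by
      split_ifs
      · exact plaquetteCorr_le ρ hρ μ _ _ _ _ _ _
      · exact hb0
  have s2 : (∑ i : Fin 4, ∑ j : Fin 4, ∑ k : Fin 4, ∑ l : Fin 4,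
      if 0 < i ∧ i < j ∧ k < l then
          plaquetteCorr ρ μ 0 i j (((n - 1 : ℕ) : ℤ) • Pi.single (0 : Fin 4) (1 : ℤ)) k l else 0) ≤
        ∑ i : Fin 4, ∑ j : Fin 4, ∑ k : Fin 4, ∑ l : Fin 4, 2 * (N : ℝ) ^ 2 :=
    Finset.sum_le_sum fun i _ => Finset.sum_le_sum fun j _ => Finset.sum_le_sum fun k _ =>
      Finset.sum_le_sum fun l _ => by
        split_ifs
        · exact plaquetteCorr_le ρ hρ μ _ _ _ _ _ _
        · exact hb0
  simp only [Finset.sum_const, Finset.card_univ, Fintype.card_fin, nsmul_eq_mul, Nat.cast_ofNat] at s1 s2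
  unfold hF
  linarith

end LimitState

/-! ### Assembly in a limit state -/

section Main

/-- **Reflection positivity of the composite OS vector in a torus-limit state** (`β ≥ 0`, continuous unitary `ρ`, any compact `G`): for
`n ≥ 1`, `0 ≤ F_μ(n)`, `F_μ(n+1) ≤ F_μ(n)` and `F_μ(n+1)² ≤ F_μ(n) F_μ(n+2)`. [folklore] -/
theorem hankel_of_mem_limitPoints (hρ : Continuous ρ) (hρu : ∀ g, ρ g ∈ Matrix.unitaryGroup (Fin N) ℂ)
    [SecondCountableTopology G] {β : ℝ} (hβ : 0 ≤ β)
    {μ : Measure (LGConfig 4 G)} (hμ : μ ∈ infiniteVolumeLimitPoints (d := 4) ρ β) {n : ℕ} (hn : 1 ≤ n) :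
    0 ≤ hF ρ μ n ∧ hF ρ μ (n + 1) ≤ hF ρ μ n ∧ hF ρ μ (n + 1) ^ 2 ≤ hF ρ μ n * hF ρ μ (n + 2) := by
  obtain ⟨Ls, hLs, hlim⟩ := hμ
  haveI : IsProbabilityMeasure μ := hlim.1
  -- the torus reflection-paired correlators along the defining tori
  set T : (k : ℕ) → ZMod (Ls k + 1) → ℝ := fun k c =>
    ∑ q : {p : Fin 4 × Fin 4 // p.1 < p.2}, ∑ q' : {p : Fin 4 × Fin 4 // p.1 < p.2},
      cov[fun U => WilsonRP.plaqRe ρ U ((Pi.single 0 0 : Site 4 (Ls k + 1)), q),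
        fun U => WilsonRP.plaqRe ρ U ((Pi.single 0 (c - (if q.1.1 = 0 then (0 : ZMod (Ls k + 1)) else 1)) :
          Site 4 (Ls k + 1)), q'); wilsonMeasure (d := 4) (L := Ls k + 1) ρ β] with hTdef
  have hT : ∀ m : ℕ, 1 ≤ m → Tendsto (fun k : ℕ => T k ((m : ℕ) : ZMod (Ls k + 1))) atTop (𝓝 (hF ρ μ m)) := by
    intro m hm
    rw [hF_eq_sum_planes ρ μ m]
    exact tendsto_torusF ρ hρ hlim hm
  have hev : ∀ c : ℕ, ∀ᶠ k : ℕ in atTop, c ≤ Ls k + 1 := fun c =>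
    (hLs.tendsto_atTop.eventually (eventually_ge_atTop c)).mono fun k hk => by omega
  -- (1) non-negativity from index `1`, and at `0` (a variance)
  have hnonneg : ∀ m, 0 ≤ hF ρ μ m := by
    intro m
    rcases Nat.eq_zero_or_pos m with rfl | hm
    · exact hF_zero_nonneg ρ hρ hρu μ
    · exact ge_of_tendsto (hT m hm) ((hev (m + 4)).mono fun k hk =>
        torusF_nonneg ρ (fun c => rfl) hρ hβ hm hk)
  -- (2) log-convexity from index `1`
  have hlc : ∀ m, 1 ≤ m → hF ρ μ (m + 1) ^ 2 ≤ hF ρ μ m * hF ρ μ (m + 2) := fun m hm =>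
    le_of_tendsto_of_tendsto ((hT (m + 1) (by omega)).pow 2) ((hT m hm).mul (hT (m + 2) (by omega)))
      ((hev (m + 7)).mono fun k hk => torusF_logConvex ρ (fun c => rfl) hρ hβ hm hk)
  -- (3) monotonicity: bounded, non-negative, log-convex from `1`
  have hmono : hF ρ μ (n + 1) ≤ hF ρ μ n :=
    AxialLogConvexity.antitone_step_of_logConvex hnonneg (fun m => hF_le ρ hρ μ m) hlc hn
  exact ⟨hnonneg n, hmono, hlc n hn⟩

end Main

end LogConvex

/-! ### The stub -/

/-- **STUB 3 of the registered skeleton of crux `HankelDensityFloor` (stmt-QuantumFields-26618), proved: `HankelLogConvex`.**  For every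
compact simple `G`, faithful unitary `r`, `β ≥ 0`, every infinite-volume torus-limit state `μ` and `n ≥ 1`: `0 ≤ F_μ(n)`, `F_μ(n+1) ≤ F_μ(n)`,
`F_μ(n+1)² ≤ F_μ(n) F_μ(n+2)` for the reflection-paired density correlator `F_μ = hF r.ρ μ`.  Osterwalder–Seiler reflection positivity of the
torus Wilson states in link AND site hyperplanes (odd tori: the mixed reflection, used at both of its fixed hyperplanes) for the composite
six-plane axial observables (part I, `…LogConvexTorus`), passage to the limit point along its defining tori, `F_μ(0) = Var ≥ 0`, and
`AxialLogConvexity.antitone_step_of_logConvex`; the simplicity of `G` is not used.  NOT the Yang–Mills mass gap; the crux stays open (door 1). -/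
theorem stub_hankelLogConvex : HankelLogConvex := by
  intro G _ _ _ _ _ _ _ r β hβ μ hμ n hn
  haveI : SecondCountableTopology G :=
    (r.continuous.isClosedEmbedding r.injective).isEmbedding.secondCountableTopology
  exact LogConvex.hankel_of_mem_limitPoints r.ρ r.continuous r.mem_unitary hβ hμ hn

end Summit.QuantumFields.YangMills.Theorems.HankelDensitySplitting

end
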